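import Summits.BirchSwinnertonDyer.BirchSwinnertonDyer.Theorems.ResidualThetaTransportAtTwoSignedMuVanishingAtTwoPlusCuspSpanFlat
import Summits.BirchSwinnertonDyer.BirchSwinnertonDyer.Theorems.ResidualThetaTransportAtTwoThetaLayerLambdaCongruenceAtTwoCuspSpanRowInductionOdd
import Summits.BirchSwinnertonDyer.BirchSwinnertonDyer.Theorems.ThetaPartnerAtTwoSignedMainConjectureCMTwoRankZeroFlatOfCuspSpan
import HarnessLib

/-!
# Route `ThetaPartnerAtTwo` (TP2), crux μ♭ `AnalyticMuFlatCMTwoRankZero` (stmt-BirchSwinnertonDyer-26470): the CURVE-FREE headline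
# behind the closure — `2 ∤ L♭` for every Pollack pair at `2` of every rational newform of odd level with `a₂ = 0`

Cell `pub/bsd-wall`, width seat `bsd-tp2-w7` g0 (director-bsd keying brief (195); THEOREMS ONLY — no `def`, no `sorry`; helper
`--supports stmt-BirchSwinnertonDyer-26470`; BSD is not proved by any of this).

WHAT IS HERE. The crux μ♭ (26470) and every other consumer of the node (G′) (item 27436, CLOSED) are stated for the newform OF A
CURVE (`IsNewformOf A f`, `GoodSS A 2`, `A.frobeniusTrace 2 = 0`). The two tree theorems that do the work are curve-free:
`SignedMuAtTwo.exists_two_le_norm_ratPlusSymbol_of_cuspSpan` (rtt-p4 g5: for a normalised newform `f ∈ S₂(Γ₀(N))` with rational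
coefficients, odd `N`, `a₂(f) = 0`, (G′)_N ⟹ some plus symbol `[5^s/2^{n+2}]⁺_f`, `n` even, has `2`-adic norm `≥ 2`) and
`SignedMuAtTwo.flatAtTwo_of_two_le_norm_ratPlusSymbol` (FlatSymbols door p578368: such a symbol ⟹ `2 ∤ L♭` for every Pollack pair of
`f` at `2`); and (G′)_N is now a theorem at every odd `N` (`SignedMuAtTwo.Rows.cuspSpanEvenAtTwo_of_not_two_dvd`, rtt-p3-w2 g5,
p643326). This file records the resulting UNCONDITIONAL, CURVE-FREE statements (no curve, no CM, no rank, no zone):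

* `exists_two_le_norm_ratPlusSymbol_of_isNewform0` — some `[5^s/2^{n+2}]⁺_f` (`n` even) has `‖·‖₂ ≥ 2`;
* `not_two_dvd_flat_of_isNewform0` — `2 ∤ L♭` for every Pollack pair `(L♯, L♭)` of `f` at `2`;
* `exists_isUnit_coeff_flat_of_isNewform0` / `exists_isUnit_coeff_kobayashiL_one_of_isNewform0` — the same in the unit-coefficient
  currency of item 26470 (`kobayashiL 1 L♯ L♭ = L♭`).

HONEST FRAMING: this is `μ(L♭_f) = 0` at `p = 2` in the TREE's normalisation (`ratPlusSymbol` w.r.t. `Ω⁺_f` with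
`re Λ_f = (Ω⁺_f/2)ℤ`; `mazurTateElement f 2 n` at level `2^{n+2}`; `IsPollackPair` = Pollack's interpolation congruences, the pair
being unique when it exists). Existence of a Pollack pair at `2` is a separate tree theorem for newforms of curves with `L(E,1) ≠ 0`
(`exists_isPollackPair_two`); for an `f` with no Pollack pair the `∀` is vacuous. Not BSD, not a main conjecture.

References: R. Pollack, Duke Math. J. 118 (2003), Conj. 6.3, Prop. 6.18 [Pollack2003]; R. Pollack, T. Weston, Duke Math. J. 156
(2011), Thm. 1.1, §3 [PollackWeston2011MT]; B. Mazur, J. Tate, J. Teitelbaum, Invent. Math. 84 (1986) §I.8 [MazurTateTeitelbaum1986Invent].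
-/

set_option autoImplicit false
-- the Theorems namespace of this sub repeats the summit name by design (D-0017 nested layout)
set_option linter.dupNamespace false

noncomputable section

open scoped Classical MatrixGroups ModularForm

open CongruenceSubgroup Literature.NumberTheory.EllipticCurves Literature.NumberTheory.EllipticCurves.ModularForms
  Literature.NumberTheory.IwasawaTheory Summit.BirchSwinnertonDyer.Rank1Residual.Supersingular

namespace Summit.BirchSwinnertonDyer.BirchSwinnertonDyer.Theorems.AnalyticMuFlatAtTwo

variable {N : ℕ} [NeZero N] {f : CuspForm (Gamma0 N) 2}

/-- **A half-integral even-layer plus symbol exists — curve-free, unconditional.** For a normalised newform `f ∈ S₂(Γ₀(N))` with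
rational coefficients, odd level `N` and `a₂(f) = 0`: some `[5^s/2^{n+2}]⁺_f` with `n` even has `2`-adic norm `≥ 2`
(`SignedMuAtTwo.exists_two_le_norm_ratPlusSymbol_of_cuspSpan` with (G′)_N discharged by `SignedMuAtTwo.Rows.cuspSpanEvenAtTwo_of_not_two_dvd`).
[cite: Pollack2003, Conj. 6.3] [cite: MazurTateTeitelbaum1986Invent, §I.8] -/
theorem exists_two_le_norm_ratPlusSymbol_of_isNewform0 (hf : IsNewform0 f) (hQ : coeffField f = ⊥) (h2N : ¬ 2 ∣ N)
    (ha₂ : cuspCoeff f 2 = 0) :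
    ∃ n : ℕ, Even n ∧ ∃ s : ZMod (2 ^ n),
      2 ≤ ‖((ratPlusSymbol f ((((cyclotomicGenerator 2 : ZMod (2 ^ (n + 2))) ^ s.val).val : ℚ) /
        (2 : ℚ) ^ (n + 2)) : ℚ) : ℚ_[2])‖ :=
  SignedMuAtTwo.exists_two_le_norm_ratPlusSymbol_of_cuspSpan f hf hQ h2N ha₂
    (SignedMuAtTwo.Rows.cuspSpanEvenAtTwo_of_not_two_dvd N h2N)

/-- **`2 ∤ L♭` — curve-free, unconditional.** For a normalised newform `f ∈ S₂(Γ₀(N))` with rational coefficients, odd level `N` and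
`a₂(f) = 0`: every Pollack pair `(L♯, L♭)` of `f` at `2` has `2 ∤ L♭` in `ℤ₂⟦T⟧` (`μ(L♭) = 0` in the tree's normalisation).
BSD is not proved by this. [cite: Pollack2003, Conj. 6.3 and Prop. 6.18] [cite: PollackWeston2011MT, Thm. 1.1] -/
theorem not_two_dvd_flat_of_isNewform0 (hf : IsNewform0 f) (hQ : coeffField f = ⊥) (h2N : ¬ 2 ∣ N) (ha₂ : cuspCoeff f 2 = 0) :
    ∀ Lsharp Lflat : IwasawaAlgebra 2, IsPollackPair f 2 Lsharp Lflat → ¬ PowerSeries.C (2 : ℤ_[2]) ∣ Lflat := by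
  obtain ⟨n, hn, s, hs⟩ := exists_two_le_norm_ratPlusSymbol_of_isNewform0 hf hQ h2N ha₂
  exact SignedMuAtTwo.flatAtTwo_of_two_le_norm_ratPlusSymbol hn hs

/-- **A unit coefficient of `L♭` — curve-free, unconditional** (the currency of item 26470: `2 ∤ L ⟺` some coefficient of `L` is a
unit of `ℤ₂`, `Theorems.exists_isUnit_coeff_of_not_C_two_dvd`). BSD is not proved by this. [cite: Pollack2003, Conj. 6.3 and Prop. 6.18] -/
theorem exists_isUnit_coeff_flat_of_isNewform0 (hf : IsNewform0 f) (hQ : coeffField f = ⊥) (h2N : ¬ 2 ∣ N)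
    (ha₂ : cuspCoeff f 2 = 0) (Lsharp Lflat : IwasawaAlgebra 2) (hP : IsPollackPair f 2 Lsharp Lflat) :
    ∃ k : ℕ, IsUnit (PowerSeries.coeff k Lflat) :=
  exists_isUnit_coeff_of_not_C_two_dvd (not_two_dvd_flat_of_isNewform0 hf hQ h2N ha₂ Lsharp Lflat hP)

/-- **The same in Kobayashi's labelling** (`kobayashiL 1 L♯ L♭ = L♭`, the shape of item 26470's conclusion) — curve-free,
unconditional. BSD is not proved by this. [cite: Kobayashi2003, (3.6) (p. 7)] [cite: Pollack2003, Conj. 6.3 and Prop. 6.18] -/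
theorem exists_isUnit_coeff_kobayashiL_one_of_isNewform0 (hf : IsNewform0 f) (hQ : coeffField f = ⊥) (h2N : ¬ 2 ∣ N)
    (ha₂ : cuspCoeff f 2 = 0) (Lsharp Lflat : IwasawaAlgebra 2) (hP : IsPollackPair f 2 Lsharp Lflat) :
    ∃ k : ℕ, IsUnit (PowerSeries.coeff k (kobayashiL 1 Lsharp Lflat)) := by
  rw [kobayashiL_one]
  exact exists_isUnit_coeff_flat_of_isNewform0 hf hQ h2N ha₂ Lsharp Lflat hP

end Summit.BirchSwinnertonDyer.BirchSwinnertonDyer.Theorems.AnalyticMuFlatAtTwo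

end
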